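import Summits.CriticalPhenomena.SAWScalingLimit.Theorems.MassRatio.Negative.Brick

/-!
# Cutting a connected set off a simply connected domain keeps it simply connected

Helper file for the crux `NoFoldBound` (stmt-CriticalPhenomena-8296) of the route `SAWDevelopingMap`
(sub-problem `SAWScalingLimit` of `CriticalPhenomena`), programme FLAT / PEELED LP of the lead seats
c9–c10 (`FLAT-LEAN-DESIGN.md` on the item), brick L2(a). The sub-domains of the peeled linear
programme are `D = Λ ∖ K` for a pool of small vertex sets `K` grown from the removed source vertex,
each connected and touching the outside of `Λ`; every use of winding rigidity
(`HexMidEdgeSAW.winding_eq_of_mem_boundary`) and of the Duminil-Copin–Smirnov identity in `D` needs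
`D` simply connected (`hexDomainSimplyConnected`: the complement induces a preconnected subgraph of
`ℍ`). This file proves it once and for all from the simple connectivity of `Λ`:

* `hexDomainSimplyConnected_sdiff` — if every vertex of `K` is linked inside `K` to a vertex of `K`
  adjacent to the outside of `Λ`, then `Λ ∖ K` is simply connected;
* `hexDomainSimplyConnected_erase` — the case `K = {v}`, `v` adjacent to the outside (the domain
  `Λ ∖ {v}` of the returning loops of `SourceLoopBound`).

Linkage inside induced subgraphs is the tree's `Linked` toolkit (`MassRatio/Negative/Brick.lean`).
-/

noncomputable section

open scoped Classical
open Literature.Probability.LatticeModels Literature.Probability.RandomPlanarGeometry.SAW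
open Summit.CriticalPhenomena.SAWScalingLimit.Theorems.MassRatio.Negative

namespace Summit.CriticalPhenomena.SAWScalingLimit.Theorems.SAWDevelopingMapNoFoldBound.Peel

/-- The complement of `Λ ∖ K` is `Λᶜ ∪ K`. -/
theorem compl_coe_sdiff (Λ K : Finset HexVertex) :
    ((↑(Λ \ K) : Set HexVertex))ᶜ = (↑Λ : Set HexVertex)ᶜ ∪ ↑K := by
  ext v
  simp only [Set.mem_compl_iff, Finset.coe_sdiff, Set.mem_sdiff, Finset.mem_coe, Set.mem_union]
  tauto

/-- **Removing a set linked to the outside.** If `Λ` is simply connected and every vertex of `K` is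
joined inside `K` to a vertex of `K` with a neighbour outside `Λ`, then `Λ ∖ K` is simply connected. -/
theorem hexDomainSimplyConnected_sdiff : ∀ {Λ K : Finset HexVertex}, hexDomainSimplyConnected Λ → (∀ k ∈ K, ∃ k₀ ∈ K, ∃ u : HexVertex, u ∉ Λ ∧ hexGraph.Adj k₀ u ∧ Summit.CriticalPhenomena.SAWScalingLimit.Theorems.MassRatio.Negative.Linked (↑K : Set HexVertex) k k₀) → hexDomainSimplyConnected (Λ \ K) := by
  intro Λ K hΛ hK
  unfold hexDomainSimplyConnected
  rw [compl_coe_sdiff]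
  set S : Set HexVertex := (↑Λ : Set HexVertex)ᶜ ∪ ↑K with hS
  have hout : (↑Λ : Set HexVertex)ᶜ ⊆ S := Set.subset_union_left
  have hin : (↑K : Set HexVertex) ⊆ S := Set.subset_union_right
  -- every vertex of `S` is linked inside `S` to a vertex outside `Λ`
  have key : ∀ x ∈ S, ∃ u : HexVertex, u ∉ Λ ∧ Linked S x u := by
    intro x hx
    rcases hx with hx | hx
    · exact ⟨x, hx, Linked.refl (hout hx)⟩
    · obtain ⟨k₀, hk₀, u, hu, hadj, hl⟩ := hK x hx
      exact ⟨u, hu, (hl.mono hin).trans (linked_of_adj (hin hk₀) (hout hu) hadj)⟩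
  refine preconnected_of_linked fun x hx y hy => ?_
  obtain ⟨u, hu, hxu⟩ := key x hx
  obtain ⟨u', hu', hyu'⟩ := key y hy
  have huu'0 : Linked ((↑Λ : Set HexVertex)ᶜ) u u' := ⟨hu, hu', hΛ ⟨u, hu⟩ ⟨u', hu'⟩⟩
  have huu' : Linked S u u' := huu'0.mono hout
  exact (hxu.trans huu').trans hyu'.symm

/-- **Removing one boundary vertex.** If `Λ` is simply connected and `v` has a neighbour outside
`Λ`, then `Λ ∖ {v}` is simply connected. -/
theorem hexDomainSimplyConnected_erase : ∀ {Λ : Finset HexVertex} {v u : HexVertex}, hexDomainSimplyConnected Λ → u ∉ Λ → hexGraph.Adj v u → hexDomainSimplyConnected (Λ.erase v) := by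
  intro Λ v u hΛ hu hvu
  rw [← Finset.sdiff_singleton_eq_erase]
  refine hexDomainSimplyConnected_sdiff hΛ fun k hk => ?_
  rw [Finset.mem_singleton] at hk
  subst hk
  exact ⟨k, Finset.mem_singleton_self k, u, hu, hvu, Linked.refl (by simp)⟩

end Summit.CriticalPhenomena.SAWScalingLimit.Theorems.SAWDevelopingMapNoFoldBound.Peel
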